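import Literature.MathematicalPhysics.QuantumFieldTheory.Balaban1983to89.B1Eq221Dictionary

/-!
# `Balaban1983to89.B1Eq221Coordinates` — T. Bałaban, *(Higgs)₂,₃ quantum fields in a finite volume. I. A lower bound*, Commun. Math. Phys. **85** (1982) 603–626 [Balaban1982Higgs1]: the INTEGRATION COORDINATES of the renormalization-transformation carriers («the natural Lebesgue measure … on the spaces of configurations», p. 605) and the constants of (2.18)/(2.19) — `(Tρ)(0) = Z` of `B1RT`/`B1Eq239Normalization` IS the closed form `zConst` ((3.31)/(3.32)), and `(Tρ)(ψ) = Z·exp(−½·coordSchur)` with no stationary point left in the statement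

statement-level skeleton of published theorems with citation tags; proofs where landed; nothing here is a claim about the Yang–Mills mass gap

PDF held: `paper:balaban1982-cmp85-higgs23-i` (journal page = PDF page + 602); pp. 605, 610, 617 [PDF 3, 8, 15] read AS
IMAGES from the ×2 renders `run/shared/lean/pub/pub-balaban/b2b-balaban-ref1/pages/1982-cmp85-higgs23-I/` (cell `pub-balaban`).

CITATION HEADER (lean-in-tree rule) — WHAT IS REPRODUCED.  Cell `lit-balaban`, Phase-2 proof seat p34 (gen 3); third file of
the (2.18)/(2.19) → (2.21) line (`B1Eq221GaussStep`: the integral on the `B1RT` carriers; `B1Eq221Dictionary`: the same in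
coordinates, = `B1RG242.StepData.Δk` and `B1Eq239Normalization.zConst`).  p. 605 [PDF 3], verbatim: *"dA, dφ denote the
natural Lebesgue measure[s] … on the spaces of configurations"*; p. 610: *"Z^ε_k(Ω,A) exp(−½⟨ψ,Δ^{(k),L^kε}(Ω,A)ψ⟩) =
T^ε_{a_k,L^k,A}[Ω, exp(−½⟨φ,(−Δ^{ε,N}_{A,Ω}+m²)φ⟩)]. (2.19) … and calculating the integral in (2.19), we obtain (2.21)"*;
p. 617: *"Z_k(A^{(k),ε}) = (a_k(L^kε)^{d−2}/2π)^{(N/2)|T^{(k)}_1|} ∫dφ exp(−½⟨φ,(G^ε_k(A^{(k),ε}))^{−1}φ⟩). (3.32)"* — the constant of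
(2.19) in closed form, with `N|T^{(k)}_1|` real output variables.

WHY THIS FILE.  `B1Eq239Normalization` (p15) left open, verbatim: *"(i) The identification of §1's `normConst` (an integral
over `X → V` for the pi-Lebesgue measure of r14's carriers) with §3's `zConst` (an integral over `ι → ℝ`) — the
measure-preserving coordinates (X → V) ≃ (ι → ℝ) and the matrix of ⟨·,·⟩_ε in them — [folklore: finite-dimensional Gaussian
integration]"*.  Here those coordinates are CONSTRUCTED (`ι := X × Fin N`, an orthonormal basis of `V ↤ R^N` per site) and shown
measure preserving, and the identification is PROVED.

DICTIONARY.  `siteCoord V : V ≃L[ℝ] (Fin N → ℝ)` ↤ orthonormal coordinates of one site value (Mathlib `stdOrthonormalBasis`;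
N = dim V); `fieldCoord V X : (X → V) ≃ₗ[ℝ] (X × Fin N → ℝ)` ↤ «the natural Lebesgue measure on the spaces of configurations»
coordinatised (`fieldCoordM` the same map as a measurable equivalence); `avgMatrix q` ↤ the matrix of the block average `Q_k(A)`
(2.11) in these coordinates; `formMatrix B` ↤ the matrix of `⟨φ,Hφ′⟩` (for (2.19): of `⟨φ,(G^ε_k)^{−1}φ⟩ − a_k(L^kε)^{d−2}|Q_kφ|²`'s
H-part); `coordA κ (avgMatrix q) (formMatrix B)` ↤ the matrix of `⟨φ,(G^ε_k)^{−1}φ⟩` in (3.32) (kernel weight included).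

WHAT IS KERNEL-CHECKED (0 sorry; axioms ⊆ {propext, Classical.choice, Quot.sound}).
 §1 `measurePreserving_uncurry` — uncurrying `(X → N → ℝ) → (X × N → ℝ)` maps the product Lebesgue measure to the product
    Lebesgue measure (Mathlib has the probability-measure version only; proved by `Measure.pi_eq` on boxes);
    `measurePreserving_siteCoord` (orthonormal-basis coordinates preserve `volume`, Mathlib) ⇒ **`measurePreserving_fieldCoordM`**
    and the change of variables **`integral_comp_fieldCoord`**: `∫_{X → V} F dφ = ∫_{X × Fin N → ℝ} F(fieldCoord⁻¹ z) dz`;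
    `sum_inner_eq_dotProduct`: `Σ_y ψ(y)·ψ′(y) = (fieldCoord ψ)·(fieldCoord ψ′)` (block-isometry).
 §2 `coordDict`: (`fieldCoord V X`, `fieldCoord V Y`, `avgMatrix q`, `formMatrix B`) is a `B1Eq221Dictionary.CoordDict`
    (`avgMatrix_mulVec`, `formMatrix_form`, by Mathlib's `LinearMap.toMatrix'`/`toMatrix₂'`); `posDef_coordA`: positivity of the
    form of `(G^ε_k)^{−1} = H + κQ^*_kQ_k` on `X → V` ⇒ `coordA` positive definite; `kernelConst_eq_rpow`:
    `((κ/2π)^{N/2})^{|Ω′|} = (κ/2π)^{N|Ω′|/2}` (κ ≥ 0) — the exponent `(N/2)|T^{(k)}_1|` of (3.32).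
 §3 **`rtOp_gaussDensity_eq_zConst`**: for κ ≥ 0, `B` symmetric with `H + κQ^*_kQ_k` positive definite,
    `B1RT.rtOp (blockKernel κ q) (gaussDensity B) ψ = zConst κ (|Y|·N) (coordA κ (avgMatrix q) (formMatrix B))
      · exp(−½·coordSchur κ (avgMatrix q) (formMatrix B) (fieldCoord ψ))` — (2.19) COMPUTED on the `B1RT` carriers with the
    constant in p15's closed form and the exponent in `B1Eq221Dictionary`'s coordinate form; **`normConst_eq_zConst`**:
    `B1Eq239Normalization.normConst (blockKernel κ q) (gaussDensity B) = zConst κ (|Y|·N) (coordA …)` — p15's item (i) CLOSED;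
    `normShape_eq` : the normalised density is `exp(−½·coordSchur … (fieldCoord ψ))`.
HONEST SCOPE.  (i) `fieldCoord` uses Mathlib's `stdOrthonormalBasis` of `V`; any orthonormal basis would do — the matrices
`avgMatrix`/`formMatrix` depend on the choice, the statements `normConst = zConst …`/`(Tρ)(ψ) = …` hold for this choice (and
`zConst`/`coordSchur` are basis-invariant quantities).  (ii) Hypotheses: κ ≥ 0 (the printed κ = a_k(L^kε)^{d−2} > 0), `B` symmetric,
`H + κQ^*_kQ_k` positive definite on `X → V` (e.g. m² > 0); nothing about Bałaban's concrete operators is asserted.  (iii) The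
weighted reading (`WE`, `wK`, `StepData.Δk`) is `B1Eq221Dictionary`'s; composing it with this file is bookkeeping left to users
(the matrices here are in orthonormal site coordinates with the kernel weight κ explicit).  Value = the coordinates and the
constant identification the cell's B1 §2 files deferred; NOT summit progress.
-/

open scoped BigOperators InnerProductSpace Matrix
open _root_.MeasureTheory _root_.Real

namespace Literature.MathematicalPhysics.QuantumFieldTheory.Balaban1983to89.B1Eq221Coordinates

/-! ## §1  Integration coordinates of the configuration spaces (p. 605) -/

/-- Uncurrying `(X → N → ℝ) → (X × N → ℝ)` preserves the product Lebesgue measures («the natural Lebesgue measure on the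
spaces of configurations» is the same whether sites and internal indices are nested or paired). [cite: Balaban1982Higgs1, p.605] -/
theorem measurePreserving_uncurry (X N : Type*) [Fintype X] [Fintype N] :
    MeasurePreserving (fun (g : X → N → ℝ) (p : X × N) => g p.1 p.2)
      (volume : Measure (X → N → ℝ)) (volume : Measure (X × N → ℝ)) := by
  have hmeas : Measurable (fun (g : X → N → ℝ) (p : X × N) => g p.1 p.2) :=
    measurable_pi_lambda _ fun p => (measurable_pi_apply p.2).comp (measurable_pi_apply p.1)
  refine ⟨hmeas, ?_⟩
  rw [show (volume : Measure (X × N → ℝ)) = Measure.pi (fun _ => volume) from rfl]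
  refine (Measure.pi_eq fun s hs => ?_).symm
  rw [Measure.map_apply hmeas (MeasurableSet.univ_pi hs)]
  have hpre : (fun (g : X → N → ℝ) (p : X × N) => g p.1 p.2) ⁻¹' Set.pi Set.univ s
      = Set.pi Set.univ (fun x => Set.pi Set.univ (fun i => s (x, i))) := by
    ext g
    simp only [Set.mem_preimage, Set.mem_univ_pi, Prod.forall]
  rw [hpre, volume_pi_pi]
  simp_rw [volume_pi_pi]
  rw [Fintype.prod_prod_type]

/-- The internal index type of one site: `Fin N`, N = dim V (V ↤ R^N of p. 605). [cite: Balaban1982Higgs1, p.605] -/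
abbrev Idx (V : Type*) [NormedAddCommGroup V] [InnerProductSpace ℝ V] : Type := Fin (Module.finrank ℝ V)

section SiteCoord

variable (V : Type*) [NormedAddCommGroup V] [InnerProductSpace ℝ V] [FiniteDimensional ℝ V]
  [MeasurableSpace V] [BorelSpace V]

/-- Orthonormal coordinates of ONE site value: `V ≃L[ℝ] (Fin N → ℝ)` (Mathlib's `stdOrthonormalBasis` followed by
`EuclideanSpace ℝ (Fin N) ≃ (Fin N → ℝ)`). [cite: Balaban1982Higgs1, p.605] -/
noncomputable def siteCoord : V ≃L[ℝ] (Idx V → ℝ) :=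
  ((stdOrthonormalBasis ℝ V).repr.toContinuousLinearEquiv).trans
    (PiLp.continuousLinearEquiv 2 ℝ (fun _ : Idx V => ℝ))

omit [MeasurableSpace V] [BorelSpace V] in
/-- `siteCoord v i = ⟪b_i, v⟫` for the standard orthonormal basis `b`. [cite: Balaban1982Higgs1, p.605] -/
theorem siteCoord_apply (v : V) (i : Idx V) :
    siteCoord V v i = (stdOrthonormalBasis ℝ V).repr v i := rfl

/-- Orthonormal coordinates preserve the Lebesgue measure of one site (Mathlib: `OrthonormalBasis.measurePreserving_repr`,
`PiLp.volume_preserving_ofLp`). [cite: Balaban1982Higgs1, p.605] -/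
theorem measurePreserving_siteCoord : MeasurePreserving (siteCoord V) :=
  (PiLp.volume_preserving_ofLp (Idx V)).comp (stdOrthonormalBasis ℝ V).measurePreserving_repr

end SiteCoord

section FieldCoord

variable (V : Type*) [NormedAddCommGroup V] [InnerProductSpace ℝ V] [FiniteDimensional ℝ V]
  [MeasurableSpace V] [BorelSpace V]
variable (X : Type*) [Fintype X]

/-- **Integration coordinates of the configuration space** `X → V` (X ↤ the sites of Ω, resp. Ω′): `φ ↦ ((x,i) ↦ ⟪b_i, φ(x)⟫)`,
a linear equivalence onto `X × Fin N → ℝ`. [cite: Balaban1982Higgs1, p.605] -/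
noncomputable def fieldCoord : (X → V) ≃ₗ[ℝ] (X × Idx V → ℝ) :=
  (LinearEquiv.piCongrRight (fun _ : X => (siteCoord V).toLinearEquiv)).trans
    (LinearEquiv.curry ℝ ℝ X (Idx V)).symm

/-- The same map as a measurable equivalence. [cite: Balaban1982Higgs1, p.605] -/
noncomputable def fieldCoordM : (X → V) ≃ᵐ (X × Idx V → ℝ) :=
  (MeasurableEquiv.piCongrRight (fun _ : X => (siteCoord V).toHomeomorph.toMeasurableEquiv)).trans
    (MeasurableEquiv.curry X (Idx V) ℝ).symm

omit [MeasurableSpace V] [BorelSpace V] [Fintype X] in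
/-- Pointwise formula (definitional). [cite: Balaban1982Higgs1, p.605] -/
theorem fieldCoord_apply (φ : X → V) (p : X × Idx V) :
    fieldCoord V X φ p = siteCoord V (φ p.1) p.2 := rfl

omit [Fintype X] in
/-- The measurable and the linear coordinate maps are the same function (definitional). [cite: Balaban1982Higgs1, p.605] -/
theorem coe_fieldCoordM : ⇑(fieldCoordM V X) = ⇑(fieldCoord V X) := rfl

omit [Fintype X] in
/-- … hence so are their inverses. [cite: Balaban1982Higgs1, p.605] -/
theorem fieldCoordM_symm_apply (z : X × Idx V → ℝ) :
    (fieldCoordM V X).symm z = (fieldCoord V X).symm z := by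
  apply (fieldCoord V X).injective
  rw [LinearEquiv.apply_symm_apply, ← coe_fieldCoordM, MeasurableEquiv.apply_symm_apply]

/-- **The coordinates preserve «the natural Lebesgue measure on the spaces of configurations»**: product over sites of the
one-site statement, then uncurrying. [cite: Balaban1982Higgs1, p.605] -/
theorem measurePreserving_fieldCoordM : MeasurePreserving (fieldCoordM V X) :=
  (measurePreserving_uncurry X (Idx V)).comp (volume_preserving_pi fun _ : X => measurePreserving_siteCoord V)

/-- **Change of variables to integration coordinates**: `∫_{X → V} F(φ) dφ = ∫_{X × Fin N → ℝ} F(fieldCoord⁻¹ z) dz` for every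
`F` (no integrability needed). [cite: Balaban1982Higgs1, p.605] -/
theorem integral_comp_fieldCoord (F : (X → V) → ℝ) :
    ∫ φ : X → V, F φ = ∫ z : X × Idx V → ℝ, F ((fieldCoord V X).symm z) := by
  rw [← ((measurePreserving_fieldCoordM V X).symm _).integral_comp' (g := F)]
  simp_rw [fieldCoordM_symm_apply]

omit [MeasurableSpace V] [BorelSpace V] in
/-- **Block-isometry**: `Σ_y ψ(y)·ψ′(y) = (fieldCoord ψ)·(fieldCoord ψ′)` — the Euclidean structure of `|ψ(y) − (Q_kφ)(y)|²` in
(2.10) is the dot product of the coordinates (orthonormality). [cite: Balaban1982Higgs1, (2.10) p.609] -/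
theorem sum_inner_eq_dotProduct {Y : Type*} [Fintype Y] (u v : Y → V) :
    ∑ y, ⟪u y, v y⟫_ℝ = fieldCoord V Y u ⬝ᵥ fieldCoord V Y v := by
  rw [dotProduct, Fintype.sum_prod_type]
  refine Finset.sum_congr rfl fun y _ => ?_
  simp only [fieldCoord_apply, siteCoord_apply, OrthonormalBasis.repr_apply_apply]
  rw [← (stdOrthonormalBasis ℝ V).sum_inner_mul_inner (u y) (v y)]
  refine Finset.sum_congr rfl fun i _ => ?_
  rw [real_inner_comm (u y)]

end FieldCoord

/-! ## §2–§3  The coordinate dictionary of record and the constants of (2.18)/(2.19) -/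

section Dict

open Matrix B1RT B1Eq221GaussStep B1Eq221Dictionary B1Eq239Normalization

variable {V : Type*} [NormedAddCommGroup V] [InnerProductSpace ℝ V] [FiniteDimensional ℝ V]
  [MeasurableSpace V] [BorelSpace V]
variable {X Y : Type*} [Fintype X] [Fintype Y] [DecidableEq X] [DecidableEq Y]

/-- The matrix of the block average `Q_k(A)` (2.11) in integration coordinates. [cite: Balaban1982Higgs1, (2.11) p.609] -/
noncomputable def avgMatrix (q : (X → V) →ₗ[ℝ] (Y → V)) : Matrix (Y × Idx V) (X × Idx V) ℝ :=
  LinearMap.toMatrix' ((fieldCoord V Y).toLinearMap ∘ₗ q ∘ₗ (fieldCoord V X).symm.toLinearMap)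

/-- The matrix of the density's form `⟨φ,Hφ′⟩` in integration coordinates. [cite: Balaban1982Higgs1, (2.17)/(2.19) p.610] -/
noncomputable def formMatrix (B : (X → V) →ₗ[ℝ] (X → V) →ₗ[ℝ] ℝ) : Matrix (X × Idx V) (X × Idx V) ℝ :=
  LinearMap.toMatrix₂' ℝ (B.compl₁₂ (fieldCoord V X).symm.toLinearMap (fieldCoord V X).symm.toLinearMap)

omit [MeasurableSpace V] [BorelSpace V] [Fintype Y] [DecidableEq Y] in
/-- `avgMatrix q` represents `q`: `(avgMatrix q)(fieldCoord φ) = fieldCoord (qφ)`. [cite: Balaban1982Higgs1, (2.11) p.609] -/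
theorem avgMatrix_mulVec (q : (X → V) →ₗ[ℝ] (Y → V)) (φ : X → V) :
    avgMatrix q *ᵥ fieldCoord V X φ = fieldCoord V Y (q φ) := by
  rw [avgMatrix, LinearMap.toMatrix'_mulVec]
  simp only [LinearMap.coe_comp, LinearEquiv.coe_coe, Function.comp_apply, LinearEquiv.symm_apply_apply]

omit [MeasurableSpace V] [BorelSpace V] [Fintype Y] [DecidableEq Y] in
/-- `formMatrix B` represents `B`: `(fieldCoord φ)ᵀ(formMatrix B)(fieldCoord χ) = B φ χ`. [cite: Balaban1982Higgs1, (2.19) p.610] -/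
theorem formMatrix_form (B : (X → V) →ₗ[ℝ] (X → V) →ₗ[ℝ] ℝ) (φ χ : X → V) :
    fieldCoord V X φ ⬝ᵥ formMatrix B *ᵥ fieldCoord V X χ = B φ χ := by
  rw [formMatrix, ← Matrix.toLinearMap₂'_apply', Matrix.toLinearMap₂'_toMatrix']
  simp only [LinearMap.compl₁₂_apply, LinearEquiv.coe_coe, LinearEquiv.symm_apply_apply]

omit [MeasurableSpace V] [BorelSpace V] [DecidableEq Y] in
/-- **The coordinate dictionary of record**: (`fieldCoord V X`, `fieldCoord V Y`, `avgMatrix q`, `formMatrix B`) satisfies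
`B1Eq221Dictionary.CoordDict` (block-isometric, represents `q` and `B`). [cite: Balaban1982Higgs1, (2.10)–(2.11) p.609] -/
theorem coordDict (κ : ℝ) (q : (X → V) →ₗ[ℝ] (Y → V)) (B : (X → V) →ₗ[ℝ] (X → V) →ₗ[ℝ] ℝ) :
    CoordDict κ q B (fieldCoord V X).toLinearMap (fieldCoord V Y).toLinearMap (avgMatrix q) (formMatrix B) where
  isom u v := sum_inner_eq_dotProduct V u v
  avg φ := (avgMatrix_mulVec q φ).symm
  form φ χ := (formMatrix_form B φ χ).symm

omit [MeasurableSpace V] [BorelSpace V] [Fintype Y] [DecidableEq Y] in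
/-- A symmetric form has a symmetric matrix. [cite: Balaban1982Higgs1, (2.17) p.610] -/
theorem formMatrix_transpose {B : (X → V) →ₗ[ℝ] (X → V) →ₗ[ℝ] ℝ} (hB : ∀ φ χ, B φ χ = B χ φ) :
    (formMatrix B)ᵀ = formMatrix B := by
  ext i j
  rw [Matrix.transpose_apply, formMatrix, LinearMap.toMatrix₂'_apply, LinearMap.toMatrix₂'_apply]
  simp only [LinearMap.compl₁₂_apply]
  exact hB _ _

omit [MeasurableSpace V] [BorelSpace V] [DecidableEq Y] in
/-- Positive definiteness of the form of `(G^ε_k)^{−1} = H + κQ^*_kQ_k` on `X → V` makes the coordinate matrix `coordA`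
positive definite (so the closed form (3.32) applies). [cite: Balaban1982Higgs1, (2.20) p.610, (3.32) p.617] -/
theorem posDef_coordA {κ : ℝ} {q : (X → V) →ₗ[ℝ] (Y → V)} {B : (X → V) →ₗ[ℝ] (X → V) →ₗ[ℝ] ℝ}
    (hB : ∀ φ χ, B φ χ = B χ φ) (hpos : ∀ φ, φ ≠ 0 → 0 < jointA κ q B φ φ) :
    (coordA κ (avgMatrix q) (formMatrix B)).PosDef := by
  refine Matrix.posDef_iff_dotProduct_mulVec.mpr ⟨?_, fun x hx => ?_⟩
  · rw [Matrix.IsHermitian, Matrix.conjTranspose_eq_transpose_of_trivial, coordA, Matrix.transpose_add,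
      Matrix.transpose_smul, Matrix.transpose_mul, Matrix.transpose_transpose, formMatrix_transpose hB]
  · have hφ : (fieldCoord V X).symm x ≠ 0 := by
      intro h0
      apply hx
      rw [← (fieldCoord V X).apply_symm_apply x, h0, map_zero]
    have h := hpos _ hφ
    rw [(coordDict κ q B).jointA_eq] at h
    simpa only [star_trivial, LinearEquiv.coe_coe, LinearEquiv.apply_symm_apply] using h

omit [MeasurableSpace V] [BorelSpace V] [Fintype X] [FiniteDimensional ℝ V] [DecidableEq X] [DecidableEq Y] in
/-- The kernel prefactor as ONE power: `((κ/2π)^{N/2})^{|Ω′|} = (κ/2π)^{(N|Ω′|)/2}` — the exponent `(N/2)|T^{(k)}_1|` of (3.31)/(3.32)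
(κ ≥ 0). [cite: Balaban1982Higgs1, (3.31)–(3.32) p.617] -/
theorem kernelConst_eq_rpow {κ : ℝ} (hκ : 0 ≤ κ) :
    kernelConst V κ Y = (κ / (2 * π)) ^ (((Fintype.card Y * Module.finrank ℝ V : ℕ) : ℝ) / 2) := by
  unfold kernelConst
  rw [← Real.rpow_mul_natCast (by positivity)]
  congr 1
  push_cast
  ring

omit [DecidableEq Y] in
/-- **(2.19) COMPUTED ON THE `B1RT` CARRIERS, CLOSED FORM**: for κ ≥ 0, `B` ↤ ⟨·,H·⟩ symmetric with `H + κQ^*_kQ_k` positive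
definite:  `T[exp(−½⟨φ,Hφ⟩)](ψ) = zConst κ (N|Ω′|) (coordA …) · exp(−½·coordSchur … (fieldCoord ψ))` — the constant `Z^ε_k` in
the closed form (3.32) (p15's `zConst`: `(κ/2π)^{N|Ω′|/2} ∫ exp(−½ zᵀAz) dz`, A the matrix of ⟨φ,(G^ε_k)^{−1}φ⟩ in integration
coordinates) times the Gaussian with the Schur-complement form (2.21) (`B1Eq221Dictionary.coordSchur`; = `B1Eq221GaussStep.schurForm`
by `CoordDict.schurForm_eq`).  Proof: change of variables `integral_comp_fieldCoord` + `B1Eq221Dictionary.integral_exp_coordExp`.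
[cite: Balaban1982Higgs1, (2.19)–(2.21) p.610, (3.32) p.617] -/
theorem rtOp_gaussDensity_eq_zConst {κ : ℝ} (hκ : 0 ≤ κ) {q : (X → V) →ₗ[ℝ] (Y → V)}
    {B : (X → V) →ₗ[ℝ] (X → V) →ₗ[ℝ] ℝ} (hB : ∀ φ χ, B φ χ = B χ φ)
    (hpos : ∀ φ, φ ≠ 0 → 0 < jointA κ q B φ φ) (ψ : Y → V) :
    rtOp (blockKernel κ q) (gaussDensity B) ψ
      = zConst κ (Fintype.card Y * Module.finrank ℝ V) (coordA κ (avgMatrix q) (formMatrix B))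
          * Real.exp (-(1 / 2 : ℝ) * coordSchur κ (avgMatrix q) (formMatrix B) (fieldCoord V Y ψ)) := by
  have D := coordDict κ q B
  simp only [rtOp_eq, blockKernel_mul_gaussDensity]
  rw [integral_comp_fieldCoord V X]
  have hpt : ∀ z : X × Idx V → ℝ,
      kernelConst V κ Y * Real.exp (-(1 / 2 : ℝ) * jointExp κ q B ψ ((fieldCoord V X).symm z))
        = kernelConst V κ Y * Real.exp (-(1 / 2 : ℝ) * coordExp κ (avgMatrix q) (formMatrix B)
            (fieldCoord V Y ψ) z) := by
    intro z
    rw [D.jointExp_eq]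
    simp only [LinearEquiv.coe_coe, LinearEquiv.apply_symm_apply]
  simp_rw [hpt]
  rw [integral_const_mul, integral_exp_coordExp (posDef_coordA hB hpos), ← mul_assoc, zConst_eq,
    kernelConst_eq_rpow hκ]

omit [DecidableEq Y] in
/-- **p15's item (i) CLOSED — `normConst = zConst`**: the normalisation factor of (2.18)/(2.19) READ on the `B1RT` carriers
(`B1Eq239Normalization.normConst = (Tρ)(0)`, an integral over `X → V`) IS the closed form `zConst` over the integration
coordinates `X × Fin N → ℝ` ((3.31)/(3.32)). [cite: Balaban1982Higgs1, (2.18)–(2.19) p.610, (3.31)–(3.32) p.617] -/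
theorem normConst_eq_zConst {κ : ℝ} (hκ : 0 ≤ κ) {q : (X → V) →ₗ[ℝ] (Y → V)}
    {B : (X → V) →ₗ[ℝ] (X → V) →ₗ[ℝ] ℝ} (hB : ∀ φ χ, B φ χ = B χ φ)
    (hpos : ∀ φ, φ ≠ 0 → 0 < jointA κ q B φ φ) :
    normConst (blockKernel κ q) (gaussDensity B)
      = zConst κ (Fintype.card Y * Module.finrank ℝ V) (coordA κ (avgMatrix q) (formMatrix B)) := by
  rw [normConst_eq, rtOp_gaussDensity_eq_zConst hκ hB hpos 0, map_zero]
  have h0 : coordSchur κ (avgMatrix q) (formMatrix B) (0 : Y × Idx V → ℝ) = 0 := by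
    unfold coordSchur
    simp
  rw [h0, mul_zero, Real.exp_zero, mul_one]

omit [DecidableEq Y] in
/-- **The Gaussian that (2.18)/(2.19) DEFINE, in closed coordinate form**: `normShape = exp(−½·coordSchur … (fieldCoord ψ))` (the
constant is positive by p15's `zConst_pos`). [cite: Balaban1982Higgs1, (2.18)–(2.21) p.610] -/
theorem normShape_eq {κ : ℝ} (hκ : 0 < κ) {q : (X → V) →ₗ[ℝ] (Y → V)}
    {B : (X → V) →ₗ[ℝ] (X → V) →ₗ[ℝ] ℝ} (hB : ∀ φ χ, B φ χ = B χ φ)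
    (hpos : ∀ φ, φ ≠ 0 → 0 < jointA κ q B φ φ) (ψ : Y → V) :
    normShape (blockKernel κ q) (gaussDensity B) ψ
      = Real.exp (-(1 / 2 : ℝ) * coordSchur κ (avgMatrix q) (formMatrix B) (fieldCoord V Y ψ)) := by
  have hZ : normConst (blockKernel κ q) (gaussDensity B) ≠ 0 := by
    rw [normConst_eq_zConst hκ.le hB hpos]
    exact (zConst_pos hκ _ (posDef_coordA hB hpos)).ne'
  unfold normShape
  rw [normConst_eq] at hZ ⊢
  rw [rtOp_gaussDensity_eq_zConst hκ.le hB hpos ψ, rtOp_gaussDensity_eq_zConst hκ.le hB hpos 0, map_zero] at *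
  have h0 : coordSchur κ (avgMatrix q) (formMatrix B) (0 : Y × Idx V → ℝ) = 0 := by
    unfold coordSchur
    simp
  rw [h0, mul_zero, Real.exp_zero, mul_one] at hZ ⊢
  rw [mul_div_cancel_left₀ _ hZ]

end Dict

end Literature.MathematicalPhysics.QuantumFieldTheory.Balaban1983to89.B1Eq221Coordinates
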